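import Summits.BirchSwinnertonDyer.BirchSwinnertonDyer.Theorems.ByReductionTypeAtTwoMultTowerSplitOneBitHolds
import Summits.BirchSwinnertonDyer.BirchSwinnertonDyer.Theorems.ByReductionTypeAtTwoMultTowerNS2TowerCosets
import Summits.BirchSwinnertonDyer.BirchSwinnertonDyer.Theorems.ByReductionTypeAtTwoMultTowerNS2TateUnitAtTwo
import Literature.NumberTheory.EllipticCurves.TateCurve.NumberFieldUniformizationTateJ
import HarnessLib

/-!
# Route `ByReductionTypeAtTwo`, crux `MultUpperHalfAtTwo` (item stmt-BirchSwinnertonDyer-19922), TOWER road, SPLIT rows: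
# ZERO BITS at a split multiplicative `2` with Tate unit `≡ ±3 (mod 8)` — the local tower kernel `𝒦_{v,n}[2^∞]` VANISHES

HONEST FRAMING (cell `bsd-2adic`, run/shared/lean/pub/bsd-2adic/, seat `bsd-2adic-tower-1` GEN 10, HUMAN RULINGS
D-0036 / D-0054 / D-0074): theorems only (no definition, no named fact, no `sorry`); closes no item by itself; nothing
booked; BSD is not proved by any of this. KERNEL counterpart, at `p = 2` and `k_q = 0`, of the PRINT binder
`hSP = Greenberg1999.sec3_natCard_localTowerKerPrimary_splitMultiplicative_rat` (Greenberg, LNM 1716, §3 p. 93: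
`|ker(r_{v_n})| ∼ log_2(q_E)/4`, a `2`-adic UNIT exactly when the Tate unit `u_q = q_E/2^{v(q_E)}` is `≡ ±3 (mod 8)`): on
those curves the split TOWER doors (`MultTowerCert.towerGapAtTwo_of_layerSelmer_cert_splitTwo`, `C₂ = 2^{k_q} = 1`) can
be fed by a tree theorem instead of `hSP` + a Tate-period certificate `(Dq, hlog, hkq)`; the displayed datum is the
decidable `(Δ_min/2^k)·c₄ ≡ ±3 (mod 8)` of the non-split one-bit rows (`…MultTowerNS2OneBitDefs.lean`).

THE PROOF (Greenberg §3 pp. 91–93 made explicit on the Tate module, as in `…MultTowerSplitOneBitHolds.lean`). With the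
SPLIT uniformisation `Φ` (`TateCurve.exists_tateUniformisation_tateJ`, kernel `q^ℤ`, honest equivariance, `tateJ q = j`)
a `2`-torsion class of `M_∞/(g−1)M_∞` (`M_∞ = E(K̄_v)^{H_∞} = Φ(L_∞ˣ)`) is `[Φ x]` with `x² = q^j · gz/z`, `x, z ∈ L_∞ˣ`.
* `j` EVEN (`j = 2c`): `y = x q^{-c}` has `y² = gz/z`, so `y = gw/w` with `w ∈ L_∞ˣ` by the cyclic Hilbert 90 one layer up
  (`exists_eq_smul_div_of_pow_eq_smul_div`, the infinite-level form of `MultTowerSP1.exists_eq_smul_div_of_prod_smul_eq_one`),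
  i.e. `Φ(x) = (g−1)Φ(w)`: the class is `0`;
* `j` ODD: at a finite level `F_{n+R} ∋ x, z` the orbit product is `N_{R+1}(x) = (q^j)^{2^R}`, i.e. `q^{2^R |j|}` is a
  relative norm from `F_{n+R+1}` (up to `x ↦ x⁻¹`) — contradicting the tower non-norm lemma BRICK 15
  `MultTowerNS2.prod_smul_ne_pow_of_tateUnit` (Tate unit `≡ 3, 5 (mod 8)` from `(Δ_min/2^k)·c₄` by BRICK 6
  `MultTowerNS2.exists_padicInt_tateUnit_of_tateJ_eq`).
So the `2`-torsion of the coinvariants is trivial, hence (BRICK 11) so is `𝒦_{v,n}[2^∞][2]`, and the `2`-primary group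
`𝒦_{v,n}[2^∞]` is `⊥`.

* `exists_eq_smul_div_of_pow_eq_smul_div` — Hilbert 90 for `⟨g⟩` on `L_∞ = K̄_v^{H_∞}` (any `p`): `y^p = gζ/ζ ⇒ y = gw/w`;
* `eq_bot_of_forall_pow_smul_eq_zero_of_torsionBy` — a `p`-power-torsion subgroup with trivial `p`-torsion is `⊥`;
* `twoTorsion_localTowerKerPrimary_le_one_splitTwo_of_tateUnit` — ZERO bits: `#𝒦_{v,n}[2^∞][2] ≤ 1`;
* `localTowerKerPrimary_eq_bot_splitTwo_of_tateUnit` — `𝒦_{v,n}[2^∞] = ⊥`.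

References: R. Greenberg, LNM 1716 (1999), §3 pp. 85–93 (esp. pp. 91–93); J. Silverman, GTM 151, Thm. V.3.1, V.5.3;
J. Neukirch, *ANT* IV (3.5), V (1.1); cell memos NOTE-SP1ONE.md §5, SCOPE-hNS2one-kernel-GEN8.md S4/S5.
-/

set_option autoImplicit false
-- the Theorems namespace of this sub repeats the summit name by design (D-0017 nested layout: Summit.<S>.<Sub>)
set_option linter.dupNamespace false

noncomputable section

open scoped Classical

namespace Summit.BirchSwinnertonDyer.BirchSwinnertonDyer.Theorems.MultTowerSP1

open NumberField IsDedekindDomain Field WeierstrassCurve PadicInt Rat.HeightOneSpectrum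
  Literature.NumberTheory.EllipticCurves Literature.NumberTheory.EllipticCurves.ResKernel
  Literature.NumberTheory.GaloisRepresentations

/-! ### Hilbert 90 for `⟨g⟩` on `L_∞ = K̄_v^{H_∞}` -/

section AnyPrime

variable {p : ℕ} [Fact p.Prime] {κ : ZpExtension ℚ p}

/-- **Hilbert 90 for the pro-cyclic local tower, infinite-level form (any `p`).** `κ` cyclotomic, `v` a place of `ℚ`,
`g ∈ Γ_{ℚ_v}` with `κ(res g) = p^n u_g` (`u_g` a unit); if `y, ζ ∈ L_∞ = K̄_v^{H_∞}`, `ζ ≠ 0`, satisfy `y^p = gζ/ζ`,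
then `y = gw/w` for some `w ∈ L_∞ˣ`. Proof: at a finite level `F_{n+R} ∋ y, ζ`
(`exists_forall_mem_localSubgroup_layerSubgroup_smul_eq`) the orbit product `N_R(y) = ∏_{i<p^R} g^i y` has
`N_R(y)^p = N_R(gζ)/N_R(ζ) = 1`, so `N_{R+1}(y) = N_R(y)^p = 1`, and the cyclic Hilbert 90 one layer up
(`exists_eq_smul_div_of_prod_smul_eq_one`) gives `w ∈ F_{n+R+1}ˣ ⊆ L_∞ˣ`. [cite: NeukirchANT1999, Ch. IV (3.5)] -/
theorem exists_eq_smul_div_of_pow_eq_smul_div (v : HeightOneSpectrum (𝓞 ℚ)) (n : ℕ)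
    {g : absoluteGaloisGroup (v.adicCompletion ℚ)} {ug : ℤ_[p]ˣ}
    (hug : ((κ (resGal (K := ℚ) (v.adicCompletion ℚ) g)).toAdd : ℤ_[p]) = (p : ℤ_[p]) ^ n * (ug : ℤ_[p]))
    {y ζ : AlgebraicClosure (v.adicCompletion ℚ)} (hζ0 : ζ ≠ 0)
    (hyL : ∀ h ∈ localSubgroup κ.kerSubgroup (v.adicCompletion ℚ), h • y = y)
    (hζL : ∀ h ∈ localSubgroup κ.kerSubgroup (v.adicCompletion ℚ), h • ζ = ζ) (hyp : y ^ p = g • ζ / ζ) :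
    ∃ w : AlgebraicClosure (v.adicCompletion ℚ), w ≠ 0 ∧
      (∀ h ∈ localSubgroup κ.kerSubgroup (v.adicCompletion ℚ), h • w = w) ∧ y = g • w / w := by
  have hile : ∀ m : ℕ, localSubgroup κ.kerSubgroup (v.adicCompletion ℚ) ≤
      localSubgroup (κ.layerSubgroup m) (v.adicCompletion ℚ) := fun m ↦ localSubgroup_ker_le_layer κ _ m
  have hgR : ∀ R : ℕ, g ^ p ^ R ∈ localSubgroup (κ.layerSubgroup (n + R)) (v.adicCompletion ℚ) := fun R ↦
    (pow_mem_localSubgroup_layerSubgroup_iff (κ := κ) v n R hug _).mpr dvd_rfl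
  -- a finite level `F_{n+R} ∋ y, ζ`
  obtain ⟨my, hmy⟩ := exists_forall_mem_localSubgroup_layerSubgroup_smul_eq (κ := κ) v y hyL
  obtain ⟨mz, hmz⟩ := exists_forall_mem_localSubgroup_layerSubgroup_smul_eq (κ := κ) v ζ hζL
  set R : ℕ := my + mz with hR
  have hyR : ∀ h ∈ localSubgroup (κ.layerSubgroup (n + R)) (v.adicCompletion ℚ), h • y = y := fun h hh ↦
    hmy h (localSubgroup_layerSubgroup_antitone κ (v.adicCompletion ℚ) (by omega) hh)
  have hζR : ∀ h ∈ localSubgroup (κ.layerSubgroup (n + R)) (v.adicCompletion ℚ), h • ζ = ζ := fun h hh ↦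
    hmz h (localSubgroup_layerSubgroup_antitone κ (v.adicCompletion ℚ) (by omega) hh)
  have hgRy : (g ^ p ^ R) • y = y := hyR _ (hgR R)
  have hgRζ : (g ^ p ^ R) • ζ = ζ := hζR _ (hgR R)
  -- orbit products: `N_R(y)^p = 1`, hence `N_{R+1}(y) = 1`
  have hNζ0 : (∏ k ∈ Finset.range (p ^ R), (g ^ k) • ζ) ≠ 0 :=
    Finset.prod_ne_zero_iff.mpr fun k _ ↦ (smul_ne_zero_iff_ne _).mpr hζ0
  have hNp : (∏ k ∈ Finset.range (p ^ R), (g ^ k) • y) ^ p = 1 := by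
    rw [← prod_smul_pow, hyp, div_eq_mul_inv, MultTowerNS2.prod_smul_mul, MultTowerNS2.prod_smul_inv,
      MultTowerNS2.prod_smul_smul_eq g (p ^ R) hgRζ, mul_inv_cancel₀ hNζ0]
  have hN1 : (∏ k ∈ Finset.range (p ^ (R + 1)), (g ^ k) • y) = 1 := by
    rw [pow_succ, prod_smul_range_mul_eq_pow g (p ^ R) hgRy p, hNp]
  -- Hilbert 90 one layer up
  have hyR1 : ∀ h ∈ localSubgroup (κ.layerSubgroup (n + (R + 1))) (v.adicCompletion ℚ), h • y = y := fun h hh ↦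
    hyR h (localSubgroup_layerSubgroup_antitone κ (v.adicCompletion ℚ) (by omega) hh)
  obtain ⟨w, hw0, hwL, hyw⟩ := exists_eq_smul_div_of_prod_smul_eq_one (κ := κ) v n (R + 1) hug hyR1 hN1
  exact ⟨w, hw0, fun h hh ↦ hwL h (hile _ hh), hyw⟩

/-- **A `p`-power-torsion subgroup with trivial `p`-torsion is trivial**: if every element of the additive subgroup
`H` is killed by a power of `p` and the elements of `H` killed by `p` number at most one, then `H = ⊥` (for `x` with
`p^{k+1} x = 0`, `p^k x` is killed by `p`, hence `0`; induct). [folklore] -/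
theorem eq_bot_of_forall_pow_smul_eq_zero_of_torsionBy {G : Type*} [AddCommGroup G] (H : AddSubgroup G) (p : ℕ)
    (hprim : ∀ x : H, ∃ k : ℕ, p ^ k • x = 0) [Finite {x : H // p • x = 0}]
    (hcard : Nat.card {x : H // p • x = 0} ≤ 1) : H = ⊥ := by
  have hsub : ∀ x : H, p • x = 0 → x = 0 := by
    intro x hx
    have hss := Finite.card_le_one_iff_subsingleton.mp hcard
    have h := hss.elim ⟨x, hx⟩ ⟨0, smul_zero _⟩
    exact congrArg Subtype.val h
  have hind : ∀ (k : ℕ) (x : H), p ^ k • x = 0 → x = 0 := by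
    intro k
    induction k with
    | zero => intro x hx; rwa [pow_zero, one_smul] at hx
    | succ k ih =>
      intro x hx
      apply ih
      apply hsub
      rw [smul_smul, ← pow_succ', hx]
  rw [eq_bot_iff]
  intro x hx
  obtain ⟨k, hk⟩ := hprim ⟨x, hx⟩
  have h := hind k ⟨x, hx⟩ hk
  rw [AddSubgroup.mem_bot]
  exact congrArg Subtype.val h

end AnyPrime

/-! ### Zero bits at a split multiplicative `2` with Tate unit `≡ ±3 (mod 8)` -/

variable {κ : ZpExtension ℚ 2}

/-- Transport of `HasSplitMultiplicativeReductionAtPrime` along an equality of primes. [folklore] -/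
private theorem hasSplitMultiplicativeReductionAtPrime_congr' (W : WeierstrassCurve ℚ) {q q' : ℕ} (h : q = q')
    [Fact q.Prime] [Fact q'.Prime] :
    W.HasSplitMultiplicativeReductionAtPrime q ↔ W.HasSplitMultiplicativeReductionAtPrime q' := by
  subst h; exact Iff.rfl

/-- **ZERO BITS at a split multiplicative `2` with Tate unit `≡ ±3 (mod 8)`: `#𝒦_{v,n}[2^∞][2] ≤ 1`.** For a globally
minimal `W/ℚ`, SPLIT multiplicative at `2`, with `Δ_min = 2^k u`, `c₄ = c`, `u·c ≡ 3` or `5 (mod 8)` (i.e. Tate unit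
`u_q ≡ ±3 (mod 8)`, equivalently `ord₂ log₂ q_E = 2`, `k_q = 0`): for every cyclotomic `ℤ₂`-datum `κ`, the place
`v ∋ 2` and every layer `n`, the `2`-torsion of the local tower kernel `𝒦_{v,n}[2^∞]` is finite with at most ONE
element. Proof: BRICK 11 embeds it into the `2`-torsion of `M_∞/(g−1)M_∞ = Φ(L_∞ˣ)/Φ(q^ℤ(g−1)L_∞ˣ)` (split Tate `Φ`
with `tateJ q = j`, `exists_unit_of_mem_fixedPoints`); a class `[Φ x]` with `x² = q^j gz/z` is `0` when `j` is even
(`exists_eq_smul_div_of_pow_eq_smul_div`) and impossible when `j` is odd (`N_{R+1}(x^{±1}) = q^{2^R|j|}` contradicts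
BRICK 15 `MultTowerNS2.prod_smul_ne_pow_of_tateUnit`, the Tate unit being `≡ 3, 5 (mod 8)` by BRICK 6).
This is the kernel form of Greenberg's `|ker(r_{v_n})| ∼ log_2(q_E)/4` (p. 93) in the unit case.
[cite: GreenbergLNM1716, §3, between Prop. 3.6 and Prop. 3.7 (PDF pp. 91–93)]
[cite: SilvermanATAEC1994, Thm. V.3.1 (c),(d), Thm. V.5.3] [cite: NeukirchANT1999, Ch. IV (3.5), Ch. V §1 Thm. (1.1)] -/
theorem twoTorsion_localTowerKerPrimary_le_one_splitTwo_of_tateUnit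
    (W : WeierstrassCurve ℚ) [W.IsElliptic] [W.IsGloballyMinimal] (hsplit : W.HasSplitMultiplicativeReductionAtPrime 2)
    (htu : ∃ (k : ℕ) (u c : ℤ), W.minimalDiscriminantInt = 2 ^ k * u ∧ W.c₄ = (c : ℚ) ∧ (u * c % 8 = 3 ∨ u * c % 8 = 5))
    (hκ : κ.IsCyclotomic) (v : HeightOneSpectrum (𝓞 ℚ)) (hv : ((2 : ℕ) : 𝓞 ℚ) ∈ v.asIdeal) (n : ℕ) :
    Finite {x : W.localTowerKerPrimary κ (v.adicCompletion ℚ) n // 2 • x = 0} ∧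
      Nat.card {x : W.localTowerKerPrimary κ (v.adicCompletion ℚ) n // 2 • x = 0} ≤ 1 := by
  obtain ⟨k, u, c, hΔ, hc₄, huc⟩ := htu
  have hmult : W.HasMultiplicativeReductionAtPrime 2 := hsplit.hasMultiplicativeReductionAtPrime
  -- S0: split multiplicative reduction at the place `v`
  haveI hfact : Fact (Nat.Prime (primesEquiv v : ℕ)) := ⟨(primesEquiv v).2⟩
  have hp2 : ((primesEquiv v : Nat.Primes) : ℕ) = 2 := primesEquiv_eq_of_natCast_mem v Nat.prime_two hv
  have hsplitv : W.HasSplitMultiplicativeReductionAt v :=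
    (hasSplitMultiplicativeReductionAtPrime_iff_hasSplitMultiplicativeReductionAt W v).mp
      ((hasSplitMultiplicativeReductionAtPrime_congr' W hp2).mpr hsplit)
  -- Tate's split uniformisation at `v`, with `tateJ q = j`
  obtain ⟨q, Φ, hq0, hqv, -, hqj, hsurj, hker, hequiv, -⟩ := TateCurve.exists_tateUniformisation_tateJ W v hsplitv
  set Q : AlgebraicClosure (v.adicCompletion ℚ) :=
    algebraMap (v.adicCompletion ℚ) (AlgebraicClosure (v.adicCompletion ℚ)) q with hQ
  have hQ0 : Q ≠ 0 := by rw [hQ]; exact (map_ne_zero _).mpr hq0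
  have hQfix : ∀ σ : absoluteGaloisGroup (v.adicCompletion ℚ), σ • Q = Q := fun σ ↦
    AlgEquiv.commutes (absoluteGaloisGroup.toAlgEquiv _ σ) q
  have hQtor : ∀ j : ℤ, Q ^ j = 1 → j = 0 := by
    intro j hj
    have hj' : q ^ j = 1 := by
      apply (algebraMap (v.adicCompletion ℚ) (AlgebraicClosure (v.adicCompletion ℚ))).injective
      rw [map_zpow₀, map_one]; exact hj
    have hq1 : ‖q‖ < 1 := Valued.toNormedField.norm_lt_one_iff.mpr hqv
    have hpow : ∀ m : ℕ, q ^ m = 1 → m = 0 := fun m hm ↦ by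
      by_contra hm0
      have h1 : ‖q‖ ^ m < 1 := pow_lt_one₀ (norm_nonneg q) hq1 hm0
      rw [← norm_pow, hm, norm_one] at h1
      exact lt_irrefl _ h1
    cases j with
    | ofNat m =>
      rw [Int.ofNat_eq_natCast, zpow_natCast] at hj'
      rw [Int.ofNat_eq_natCast, hpow m hj']
      rfl
    | negSucc m =>
      rw [zpow_negSucc, inv_eq_one] at hj'
      exact absurd (hpow (m + 1) hj') (Nat.succ_ne_zero m)
  -- equivariance in value form
  have hequiv' : ∀ (σ : absoluteGaloisGroup (v.adicCompletion ℚ)) (w w' : (AlgebraicClosure (v.adicCompletion ℚ))ˣ),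
      (w' : AlgebraicClosure (v.adicCompletion ℚ)) = σ • (w : AlgebraicClosure (v.adicCompletion ℚ)) →
        σ • Φ (Additive.ofMul w) = Φ (Additive.ofMul w') := by
    intro σ w w' h
    have hw' : w' = Units.map (absoluteGaloisGroup.toAlgEquiv (v.adicCompletion ℚ) σ :
        AlgebraicClosure (v.adicCompletion ℚ) →* AlgebraicClosure (v.adicCompletion ℚ)) w := Units.ext h
    rw [hw']
    exact hequiv σ w
  -- the Tate unit in `ℤ_[2]` (BRICK 6): `e q = 2^k u'`, `u' ≡ 3, 5 (mod 8)`
  obtain ⟨u', hq', hu'⟩ := MultTowerNS2.exists_padicInt_tateUnit_of_tateJ_eq W hmult hΔ hc₄ huc v hv hq0 hqv hqj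
  have h2p : ∀ (p : ℕ) [Fact p.Prime], p = 2 → (2 : ℚ_[p]) = (p : ℚ_[p]) := by
    intro p _ hp; subst hp; norm_cast
  have hqe : (adicCompletion.padicEquiv v).toAlgEquiv.toRingEquiv q =
      ((primesEquiv v : ℕ) : ℚ_[(primesEquiv v : ℕ)]) ^ k * (u' : ℚ_[(primesEquiv v : ℕ)]) := by
    rw [← h2p _ hp2]; exact hq'
  -- a topological generator `g ∈ H_n` of `H_n` modulo `H_∞`, `κ(res g) = 2^n · unit`
  obtain ⟨g, hgn, hgen⟩ := ZpExtension.exists_mem_localSubgroup_generate κ (v.adicCompletion ℚ) n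
  obtain ⟨ug, hug⟩ := MultTowerNS2.exists_units_kappa_resGal_eq_of_generate hκ v hv n hgn hgen
  have hugp : ((κ (resGal (K := ℚ) (v.adicCompletion ℚ) g)).toAdd : ℤ_[2]) = ((2 : ℕ) : ℤ_[2]) ^ n * (ug : ℤ_[2]) := by
    rw [Nat.cast_ofNat]; exact hug
  have hgR : ∀ R : ℕ, g ^ 2 ^ R ∈ localSubgroup (κ.layerSubgroup (n + R)) (v.adicCompletion ℚ) := fun R ↦
    (MultTowerNS2.pow_mem_localSubgroup_layerSubgroup_iff (κ := κ) v n R hug _).mpr dvd_rfl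
  -- the coinvariants `M_∞/(g-1)M_∞`
  set P := localPoints W (v.adicCompletion ℚ) with hP
  set M : AddSubgroup P :=
    FixedPoints.addSubgroup (localSubgroup κ.kerSubgroup (v.adicCompletion ℚ)) P with hM
  have memM : ∀ {a : P}, a ∈ M ↔ ∀ h ∈ localSubgroup κ.kerSubgroup (v.adicCompletion ℚ), h • a = a := fun {a} ↦ by
    rw [hM, FixedPoints.mem_addSubgroup]
    exact ⟨fun H h hh ↦ H ⟨h, hh⟩, fun H h ↦ H h h.2⟩
  set d : M →+ M := subOne (localSubgroup κ.kerSubgroup (v.adicCompletion ℚ)) P g with hd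
  have hΦM : ∀ x : (AlgebraicClosure (v.adicCompletion ℚ))ˣ,
      (∀ h ∈ localSubgroup κ.kerSubgroup (v.adicCompletion ℚ), h • (x : AlgebraicClosure (v.adicCompletion ℚ)) = x) →
        Φ (Additive.ofMul x) ∈ M := fun x hx ↦
    memM.mpr fun h hh ↦ hequiv' h x x (hx h hh).symm
  -- `σ (a / b) = σ a / σ b` on `K̄_v`
  have hsdiv : ∀ (σ : absoluteGaloisGroup (v.adicCompletion ℚ)) (a b : AlgebraicClosure (v.adicCompletion ℚ)),
      σ • (a / b) = σ • a / σ • b := fun σ a b ↦ by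
    rw [div_eq_mul_inv, smul_mul', smul_inv'', div_eq_mul_inv]
  -- every `2`-torsion class vanishes
  have key : ∀ y : {y : M ⧸ d.range // 2 • y = 0}, (y : M ⧸ d.range) = 0 := by
    rintro ⟨y, hy⟩
    obtain ⟨m, rfl⟩ := QuotientAddGroup.mk_surjective y
    obtain ⟨x, hxm, hxL⟩ := exists_unit_of_mem_fixedPoints v hsurj hker hequiv' hQfix hQ0 hQtor _ (memM.mp m.2)
    -- `2 m ∈ (g-1) M_∞`
    have h2m : (2 • m : M) ∈ d.range := by
      rw [← QuotientAddGroup.eq_zero_iff]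
      exact hy
    obtain ⟨w, hw⟩ := h2m
    obtain ⟨z, hzm, hzL⟩ := exists_unit_of_mem_fixedPoints v hsurj hker hequiv' hQfix hQ0 hQtor _ (memM.mp w.2)
    -- `Φ (x²) = Φ (gz / z)`, so `x² = Q^j · gz/z`
    set gz : (AlgebraicClosure (v.adicCompletion ℚ))ˣ :=
      Units.mk0 (g • (z : AlgebraicClosure (v.adicCompletion ℚ))) ((smul_ne_zero_iff_ne g).mpr z.ne_zero) with hgz
    have hgΦ : g • Φ (Additive.ofMul z) = Φ (Additive.ofMul gz) := hequiv' g z gz rfl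
    have h3 : Φ (Additive.ofMul (x ^ 2)) = Φ (Additive.ofMul (gz * z⁻¹)) := by
      rw [ofMul_pow, map_nsmul, hxm, ofMul_mul, ofMul_inv, map_add, map_neg, ← hgΦ, hzm, ← sub_eq_add_neg]
      have h4 := congrArg (fun b : M ↦ (b : P)) hw
      simp only [hd, AddSubgroupClass.coe_nsmul] at h4
      exact h4.symm
    rw [MultTowerNS2.tatePsi_eq_iff v hker] at h3
    obtain ⟨j, hj⟩ := h3
    rw [Units.val_pow_eq_pow_val, Units.val_mul, Units.val_inv_eq_inv_val, hgz, Units.val_mk0, ← div_eq_mul_inv] at hj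
    have hx0 : (x : AlgebraicClosure (v.adicCompletion ℚ)) ≠ 0 := x.ne_zero
    have hz0 : (z : AlgebraicClosure (v.adicCompletion ℚ)) ≠ 0 := z.ne_zero
    change (QuotientAddGroup.mk m : M ⧸ d.range) = 0
    rcases Int.even_or_odd j with ⟨c', hc'⟩ | hodd
    · -- `j = 2c'`: `y = x Q^{-c'}` has `y² = gz/z`, so `y = gw/w` and `Φ x = (g-1) Φ w`
      set yy : AlgebraicClosure (v.adicCompletion ℚ) := (x : AlgebraicClosure (v.adicCompletion ℚ)) * Q ^ (-c')
        with hyy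
      have hyL : ∀ h ∈ localSubgroup κ.kerSubgroup (v.adicCompletion ℚ), h • yy = yy := fun h hh ↦ by
        rw [hyy, smul_mul', smul_zpow₀', hxL h hh, hQfix]
      have hζ0 : (z : AlgebraicClosure (v.adicCompletion ℚ)) ≠ 0 := hz0
      have hyp : yy ^ 2 = g • (z : AlgebraicClosure (v.adicCompletion ℚ)) / z := by
        rw [hyy, mul_pow, hj, hc', ← zpow_natCast (Q ^ (-c')) 2, ← zpow_mul]
        push_cast
        rw [show -c' * 2 = -(c' + c') by ring, zpow_neg, mul_assoc, mul_comm (g • (z : AlgebraicClosure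
          (v.adicCompletion ℚ)) / z), ← mul_assoc, mul_inv_cancel₀ (zpow_ne_zero _ hQ0), one_mul]
      obtain ⟨w', hw'0, hw'L, hyw⟩ := exists_eq_smul_div_of_pow_eq_smul_div (κ := κ) v n hugp hζ0 hyL hzL hyp
      -- `Φ x = (g - 1) Φ w'`
      set wu : (AlgebraicClosure (v.adicCompletion ℚ))ˣ := Units.mk0 w' hw'0 with hwu
      have hwM : Φ (Additive.ofMul wu) ∈ M := hΦM wu fun h hh ↦ by rw [hwu, Units.val_mk0]; exact hw'L h hh
      set gw : (AlgebraicClosure (v.adicCompletion ℚ))ˣ := Units.mk0 (g • w') ((smul_ne_zero_iff_ne g).mpr hw'0)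
        with hgw
      have hgΦw : g • Φ (Additive.ofMul wu) = Φ (Additive.ofMul gw) :=
        hequiv' g wu gw (by rw [hgw, hwu, Units.val_mk0, Units.val_mk0])
      have hdP : (d ⟨Φ (Additive.ofMul wu), hwM⟩ : P) = g • Φ (Additive.ofMul wu) - Φ (Additive.ofMul wu) := rfl
      have hxd : Φ (Additive.ofMul x) = (d ⟨Φ (Additive.ofMul wu), hwM⟩ : P) := by
        rw [hdP, hgΦw]
        have e2 : Φ (Additive.ofMul gw) - Φ (Additive.ofMul wu) = Φ (Additive.ofMul (gw * wu⁻¹)) := by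
          rw [ofMul_mul, ofMul_inv, map_add, map_neg, sub_eq_add_neg]
        rw [e2, MultTowerNS2.tatePsi_eq_iff v hker]
        refine ⟨c', ?_⟩
        rw [Units.val_mul, Units.val_inv_eq_inv_val, hgw, hwu, Units.val_mk0, Units.val_mk0, ← div_eq_mul_inv, ← hyw,
          hyy, mul_comm, mul_assoc, ← zpow_add₀ hQ0, neg_add_cancel, zpow_zero, mul_one]
      rw [QuotientAddGroup.eq_zero_iff]
      refine ⟨⟨Φ (Additive.ofMul wu), hwM⟩, Subtype.ext ?_⟩
      rw [← hxm]
      exact hxd.symm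
    · -- `j` odd: `N_{R+1}(x^{±1}) = q^{2^R |j|}` contradicts the tower non-norm lemma (BRICK 15)
      exfalso
      have hile : ∀ m : ℕ, localSubgroup κ.kerSubgroup (v.adicCompletion ℚ) ≤
          localSubgroup (κ.layerSubgroup m) (v.adicCompletion ℚ) := fun m ↦ localSubgroup_ker_le_layer κ _ m
      obtain ⟨mx, hmx⟩ := exists_forall_mem_localSubgroup_layerSubgroup_smul_eq (κ := κ) v
        (x : AlgebraicClosure (v.adicCompletion ℚ)) hxL
      obtain ⟨mz, hmz⟩ := exists_forall_mem_localSubgroup_layerSubgroup_smul_eq (κ := κ) v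
        (z : AlgebraicClosure (v.adicCompletion ℚ)) hzL
      set R : ℕ := mx + mz with hR
      have hxR : ∀ h ∈ localSubgroup (κ.layerSubgroup (n + R)) (v.adicCompletion ℚ),
          h • (x : AlgebraicClosure (v.adicCompletion ℚ)) = x := fun h hh ↦
        hmx h (localSubgroup_layerSubgroup_antitone κ (v.adicCompletion ℚ) (by omega) hh)
      have hzR : ∀ h ∈ localSubgroup (κ.layerSubgroup (n + R)) (v.adicCompletion ℚ),
          h • (z : AlgebraicClosure (v.adicCompletion ℚ)) = z := fun h hh ↦
        hmz h (localSubgroup_layerSubgroup_antitone κ (v.adicCompletion ℚ) (by omega) hh)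
      have hxR1 : ∀ h ∈ localSubgroup (κ.layerSubgroup (n + (R + 1))) (v.adicCompletion ℚ),
          h • (x : AlgebraicClosure (v.adicCompletion ℚ)) = x := fun h hh ↦
        hxR h (localSubgroup_layerSubgroup_antitone κ (v.adicCompletion ℚ) (by omega) hh)
      have hgRx : (g ^ 2 ^ R) • (x : AlgebraicClosure (v.adicCompletion ℚ)) = x := hxR _ (hgR R)
      have hgRz : (g ^ 2 ^ R) • (z : AlgebraicClosure (v.adicCompletion ℚ)) = z := hzR _ (hgR R)
      -- `N_{R+1}(x) = (Q^j)^{2^R}`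
      have hprodz : (∏ i ∈ Finset.range (2 ^ R), (g ^ i) • (g • (z : AlgebraicClosure (v.adicCompletion ℚ)) / z)) = 1 := by
        rw [Finset.prod_congr rfl fun i _ ↦ show (g ^ i) • (g • (z : AlgebraicClosure (v.adicCompletion ℚ)) / z) =
            (g ^ i) • (g • (z : AlgebraicClosure (v.adicCompletion ℚ))) * (g ^ i) • (z : AlgebraicClosure
              (v.adicCompletion ℚ))⁻¹ by rw [div_eq_mul_inv, smul_mul'],
          Finset.prod_mul_distrib, MultTowerNS2.prod_smul_smul_eq g (2 ^ R) hgRz, MultTowerNS2.prod_smul_inv,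
          mul_inv_cancel₀]
        exact Finset.prod_ne_zero_iff.mpr fun i _ ↦ (smul_ne_zero_iff_ne _).mpr hz0
      have hNx : (∏ i ∈ Finset.range (2 ^ (R + 1)), (g ^ i) • (x : AlgebraicClosure (v.adicCompletion ℚ))) =
          (Q ^ j) ^ 2 ^ R := by
        rw [pow_succ', MultTowerNS2.prod_smul_range_two_mul, MultTowerNS2.pow_smul_prod_smul_eq g (2 ^ R) hgRx, ← sq,
          ← prod_smul_pow, hj, MultTowerNS2.prod_smul_mul, hprodz, mul_one,
          MultTowerNS2.prod_smul_eq_pow_of_smul_eq g (2 ^ R) (by rw [smul_zpow₀', hQfix])]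
      -- exponent `|j|` odd
      obtain ⟨j₀, hj₀⟩ : ∃ j₀ : ℕ, j = j₀ ∨ j = -j₀ := ⟨j.natAbs, Int.natAbs_eq j⟩
      have hj₀odd : Odd j₀ := by
        rcases hj₀ with h | h
        · exact_mod_cast (h ▸ hodd : Odd (j₀ : ℤ))
        · have : Odd (-(j₀ : ℤ)) := h ▸ hodd
          exact_mod_cast (odd_neg.mp this)
      have hpow : (Q ^ (j₀ : ℤ)) ^ 2 ^ R =
          algebraMap (v.adicCompletion ℚ) (AlgebraicClosure (v.adicCompletion ℚ)) (q ^ (2 ^ (R + 1 - 1) * j₀)) := by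
        rw [Nat.add_sub_cancel, zpow_natCast, hQ, ← map_pow, ← map_pow, ← pow_mul, mul_comm]
      rcases hj₀ with h | h
      · refine MultTowerNS2.prod_smul_ne_pow_of_tateUnit hκ v hv (primesEquiv v : ℕ) hp2
          (adicCompletion.padicEquiv v).toAlgEquiv.toRingEquiv hqe hu' n hug (R := R + 1) (by omega) hj₀odd hxR1 ?_
        rw [hNx, h, hpow]
      · have hxR1' : ∀ h ∈ localSubgroup (κ.layerSubgroup (n + (R + 1))) (v.adicCompletion ℚ),
            h • (x : AlgebraicClosure (v.adicCompletion ℚ))⁻¹ = (x : AlgebraicClosure (v.adicCompletion ℚ))⁻¹ :=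
          fun h hh ↦ by rw [smul_inv'', hxR1 h hh]
        refine MultTowerNS2.prod_smul_ne_pow_of_tateUnit hκ v hv (primesEquiv v : ℕ) hp2
          (adicCompletion.padicEquiv v).toAlgEquiv.toRingEquiv hqe hu' n hug (R := R + 1) (by omega) hj₀odd hxR1' ?_
        rw [MultTowerNS2.prod_smul_inv, hNx, h, ← hpow, zpow_neg, inv_pow, inv_inv]
  -- hence the `2`-torsion of the coinvariants is trivial
  haveI hss : Subsingleton {y : M ⧸ d.range // 2 • y = 0} := ⟨fun a b ↦ Subtype.ext ((key a).trans (key b).symm)⟩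
  haveI hfin : Finite {y : M ⧸ d.range // 2 • y = 0} := Finite.of_subsingleton
  have hcard : Nat.card {y : M ⧸ d.range // 2 • y = 0} ≤ 1 := Finite.card_le_one_iff_subsingleton.mpr hss
  -- BRICK 11
  have h11 := MultTowerNS2.finite_torsionBy_localTowerKerPrimary_and_card_le W κ (v.adicCompletion ℚ) n hgn hgen 2
  exact ⟨h11.1, h11.2.trans hcard⟩

/-- **`𝒦_{v,n}[2^∞] = 0` at a split multiplicative `2` with Tate unit `≡ ±3 (mod 8)`** (every layer `n`): the local tower
kernel's `2`-primary part is trivial — Greenberg's `|ker(r_{v_n})| ∼ log_2(N q_E)/4[F_v ∩ ℚ_2^cyc : ℚ_2]`, a `2`-adic unit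
here, as a KERNEL theorem (`twoTorsion_localTowerKerPrimary_le_one_splitTwo_of_tateUnit` +
`eq_bot_of_forall_pow_smul_eq_zero_of_torsionBy`). [cite: GreenbergLNM1716, §3, between Prop. 3.6 and Prop. 3.7 (PDF pp. 91–93)] -/
theorem localTowerKerPrimary_eq_bot_splitTwo_of_tateUnit
    (W : WeierstrassCurve ℚ) [W.IsElliptic] [W.IsGloballyMinimal] (hsplit : W.HasSplitMultiplicativeReductionAtPrime 2)
    (htu : ∃ (k : ℕ) (u c : ℤ), W.minimalDiscriminantInt = 2 ^ k * u ∧ W.c₄ = (c : ℚ) ∧ (u * c % 8 = 3 ∨ u * c % 8 = 5))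
    (hκ : κ.IsCyclotomic) (v : HeightOneSpectrum (𝓞 ℚ)) (hv : ((2 : ℕ) : 𝓞 ℚ) ∈ v.asIdeal) (n : ℕ) :
    W.localTowerKerPrimary κ (v.adicCompletion ℚ) n = ⊥ := by
  obtain ⟨hfin, hcard⟩ := twoTorsion_localTowerKerPrimary_le_one_splitTwo_of_tateUnit W hsplit htu hκ v hv n
  haveI := hfin
  refine eq_bot_of_forall_pow_smul_eq_zero_of_torsionBy _ 2 (fun x ↦ ?_) hcard
  obtain ⟨-, k, hk⟩ := (W.mem_localTowerKerPrimary_iff κ (v.adicCompletion ℚ) n x.1).mp x.2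
  exact ⟨k, Subtype.ext hk⟩

end Summit.BirchSwinnertonDyer.BirchSwinnertonDyer.Theorems.MultTowerSP1

end
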